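import Literature.AlgebraicGeometry.Pohlmann1968.ExceptionalHodgeClassesCMWeilType
import Literature.AlgebraicGeometry.Pohlmann1968.SimpleCMAbelianVarietiesExceptionalDimensions
import Literature.AlgebraicGeometry.ComplexMultiplication.CMAbelianVarietyRealisedHolds
import Literature.Barriers.HodgeConjecture.CMHodgeRingNotGeneratedInCodimensionTwo
import HarnessLib

/-!
# Discharge of the barrier facts `Weil1977_exceptionalHodgeClasses` and
# `Mumford1968_simpleFourfold_exceptionalHodgeClasses`, and the exceptional-class existence theorems
# of `Pohlmann1968/` WITHOUT the existence hypothesis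

Barrier catalogue `Literature/Barriers/HodgeConjecture` (D-0021); proofs-only file (no definition, no new named
fact, no `sorry`).  The two named facts of `ExceptionalHodgeClasses.lean`,

* `Literature.Barriers.HodgeConjecture.Weil1977_exceptionalHodgeClasses` (:135) — van Geemen 1994 Thm. 4.11
  (Weil 1977): for every `n ≥ 2` an abelian `2n`-fold with a rational `(n,n)`-class outside `Dⁿ`;
* `Literature.Barriers.HodgeConjecture.Mumford1968_simpleFourfold_exceptionalHodgeClasses` (:155) — van Geemen
  1994 Thm. 4.5 «(Mumford, [Po]) There exist simple four dimensional abelian varieties with `B² ≠ D²`»,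

were reduced in `Literature/` to ONE hypothesis, the existence of abelian varieties of every CM type read on `H¹`
(Shimura 1998 §6.2 Thm. 3 = the record `Literature.NumberTheory.Automorphic.PicardCM.CMAbelianVarietyRealised`):
`Pohlmann1968.WeilTypeWitness.weil1977_exceptionalHodgeClasses_of_cmAbelianVarietyRealised` (CM witnesses
`A₉ × E^{2n-3}`) and `Pohlmann1968.MumfordFourfold.mumford1968_simpleFourfold_exceptionalHodgeClasses_of_cmAbelianVarietyRealised`
(Mumford's own octic example `K = ℚ(α, i)`, `3α⁴ − 6α² + α + 1 = 0`).  That record is now a theorem OF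
`Literature/` — `PicardCM.CMAbelianVarietyRealised_holds` (`ComplexMultiplication/CMAbelianVarietyRealisedHolds`,
Shimura's Thm. 3 through the Riemann form of Thm. 4, Lefschetz–Chow–GAGA, and endomorphism descent) — so the
closing lines can be written inside `Literature/` (the summit side has its own closed twins in
`Summits/HodgeConjecture/CorCM/Assembly/ExceptionalHodgeClassesHold`, which `Literature/` cannot import):

* `Weil1977_exceptionalHodgeClasses_holds`, `Mumford1968_simpleFourfold_exceptionalHodgeClasses_holds` — the two
  barrier facts HOLD (exact-name discharges);
* `cmProduct_hodgeRing_not_generated_in_codim_two` — Hazama 2003 Remark 7.15 (this catalogue's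
  `CMHodgeRingNotGeneratedInCodimensionTwo`, there modulo the record `h₃`) for EVERY CM field `K` of degree `8`
  and every CM type `Φ`, now hypothesis-free; `exists_abelianVariety_hodgeRing_not_generated_in_codim_two` — the
  closed existence form (on the six-fold product over Mumford's octic CM field): a complex abelian variety with a
  rational `(3,3)`-class outside the part of its Hodge ring generated in codimension `≤ 2`;
* in `namespace Literature.AlgebraicGeometry.Pohlmann1968` (the lane of the reductions): the Mumford–Pohlmann /
  Dodson 1984 / Ribet 1983 DICHOTOMY of `SimpleCMAbelianVarietiesExceptionalDimensions` without its `hreal`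
  binder — `exists_simple_cmType_fourfold_not_isDivisorGenerated` (a simple CM fourfold which is itself not
  divisor-generated), `exists_simple_cmType_not_isDivisorGenerated_powSucc` (every composite `n ≥ 4`),
  `exists_simple_cmType_not_isDivisorGenerated_powSucc_iff` and `exists_simple_cmType_mtRank_lt_iff`
  (**for `n ≥ 1`: a simple complex abelian variety of CM type and dimension `n` some power of which carries an
  exceptional Hodge class — equivalently, degenerate in Dodson's sense `dim MT < n + 1` — exists iff `n` is
  composite**), and Dodson's §3.2.1 rank statement `exists_simple_degenerate_cmType_of_eq_mul` /
  `exists_simple_degenerate_cmType_of_not_prime` (rank `n − l + 2` for `n = kl`, `k ≥ 3`, `l ≥ 2`).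

Every proof is the corresponding conditional theorem of the tree applied to `PicardCM.CMAbelianVarietyRealised_holds`;
nothing is re-derived.

## References

* [vanGeemen1994HodgeAV] B. van Geemen, *An introduction to the Hodge conjecture for abelian varieties*, LNM 1594
  (1994), §2.4–2.5, Thm. 4.5, 4.7, Thm. 4.11.
* [Weil1977HodgeRing] A. Weil, *Abelian varieties and the Hodge ring* [1977c], Œuvres III, 421–429.
* [Pohlmann1968] H. Pohlmann, *Algebraic cycles on abelian varieties of complex multiplication type*, Ann. of Math.
  (2) 88 (1968) 161–180, Thm. 1 and §3 (Mumford's example; MR 37 #4080).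
* [Dodson1984] B. Dodson, *The structure of Galois groups of CM-fields*, Trans. AMS 283 (1984) 1–32: abstract, p. 2,
  §3.2.1 Theorem, §3.3.2.
* [Ribet1983] K. A. Ribet, *Hodge classes on certain types of abelian varieties*, Amer. J. Math. 105 (1983), Thms. 0–3.
* [Hazama2003GHCCM] F. Hazama, *On the general Hodge conjecture for abelian varieties of CM-type*, Publ. RIMS 39
  (2003) 625–655, Remark 7.15 p. 650.
* [Gordon1999HodgeAVSurvey] B. B. Gordon, *A survey of the Hodge conjecture for abelian varieties* (1999), Thm. 6.4,
  8.2, §9.2, 9.2.2.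
* [Shimura1998] G. Shimura, *Abelian Varieties with Complex Multiplication and Modular Functions* (1998), §6.2
  Thm. 3 (pp. 41–42), §8.2 Prop. 26.
-/

noncomputable section

/-! ### §1 The two barrier facts hold -/

namespace Literature.Barriers.HodgeConjecture

open Literature.AlgebraicGeometry.Pohlmann1968
open Literature.NumberTheory.Automorphic (PicardCM.CMAbelianVarietyRealised_holds)

/-- **`Weil1977_exceptionalHodgeClasses` HOLDS (van Geemen 1994 Thm. 4.11; Weil 1977): for every `n ≥ 2` there is a
complex abelian variety of dimension `2n` with a rational class of Hodge type `(n,n)` in `H²ⁿ(A(ℂ); ℂ)` outside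
the span `Dⁿ ⊗ ℂ` of products of divisor classes.**  The reduction
`WeilTypeWitness.weil1977_exceptionalHodgeClasses_of_cmAbelianVarietyRealised` (the CM abelian `2n`-folds
`A₉ × E^{2n-3}`, `A₉` of type `(ℚ(ζ₉); {σ₁, σ₂, σ₄})`, `E` with CM by `ℤ[ζ₃]`, and Pohlmann's criterion) applied to
the Literature theorem `PicardCM.CMAbelianVarietyRealised_holds` (Shimura 1998 §6.2 Thm. 3: abelian varieties of
every CM type exist). [cite: vanGeemen1994HodgeAV, Thm. 4.11 and 4.7] [cite: Weil1977HodgeRing]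
[cite: Pohlmann1968, Thm. 1 and §3] [cite: Shimura1998, §6.2 Theorem 3] -/
theorem Weil1977_exceptionalHodgeClasses_holds : Weil1977_exceptionalHodgeClasses :=
  WeilTypeWitness.weil1977_exceptionalHodgeClasses_of_cmAbelianVarietyRealised
    PicardCM.CMAbelianVarietyRealised_holds

/-- **`Mumford1968_simpleFourfold_exceptionalHodgeClasses` HOLDS (van Geemen 1994 Thm. 4.5 «(Mumford, [Po]) There
exist simple four dimensional abelian varieties with `B² ≠ D²`»).**  The reduction
`MumfordFourfold.mumford1968_simpleFourfold_exceptionalHodgeClasses_of_cmAbelianVarietyRealised` (Mumford's example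
as printed by Pohlmann §3: `K = ℚ(α, i)` with `3α⁴ − 6α² + α + 1 = 0`, a CM type of Weil type `(2,2)` for `ℚ(i)`,
primitive hence simple, with a Weil class outside `D² ⊗ ℂ`) applied to `PicardCM.CMAbelianVarietyRealised_holds`.
[cite: vanGeemen1994HodgeAV, Thm. 4.5 and 4.7] [cite: Pohlmann1968, §3] [cite: Gordon1999HodgeAVSurvey, 8.2 and 9.2.2]
[cite: Shimura1998, §6.2 Theorem 3 and §8.2 Prop. 26] -/
theorem Mumford1968_simpleFourfold_exceptionalHodgeClasses_holds :
    Mumford1968_simpleFourfold_exceptionalHodgeClasses :=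
  MumfordFourfold.mumford1968_simpleFourfold_exceptionalHodgeClasses_of_cmAbelianVarietyRealised
    PicardCM.CMAbelianVarietyRealised_holds

/-! ### §2 Hazama's Remark 7.15 without the existence hypothesis -/

open CategoryTheory CategoryTheory.Limits
open Literature.AlgebraicGeometry.Motives (AbelianVariety CMType)
open Literature.AlgebraicGeometry.HodgeTheory
open Literature.AlgebraicGeometry.ComplexMultiplication (IsCMTypeRealisation)
open NumberField

/-- **The Hodge ring of a CM abelian variety need not be generated in codimension `≤ 2` — for EVERY CM field `K` of
degree `8` and every CM type `Φ` of `K`, hypothesis-free** (Hazama 2003, Remark 7.15): there are six abelian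
varieties `A_0, …, A_5` with `𝓞_K`-multiplication, of CM types `u_φ (φ ∈ Φ), Φ, Φ` (`hazamaFamily`), whose product
carries a rational `(3,3)`-class outside the degree-`6` part of the ideal generated by `B¹ ⊗ ℂ`, hence outside
`B¹B¹B¹ + B¹B² + B²B¹` and outside `D³ ⊗ ℂ`.  This is `exists_cmProduct_hodgeRing_not_generated_in_codim_two` with
its record binder `h₃` fed by `PicardCM.CMAbelianVarietyRealised_holds`. [cite: Hazama2003GHCCM, Remark 7.15 p. 650]
[cite: Shimura1998, §6.2 Theorem 3] -/
theorem cmProduct_hodgeRing_not_generated_in_codim_two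
    (K : Type) [Field K] [NumberField K] [IsCMField K] (hK : Module.finrank ℚ K = 8) (Φ : CMType K) :
    ∃ (e : Fin 4 → (K →+* ℂ)) (A : Fin 6 → AbelianVariety ℂ) (ι : ∀ i : Fin 6, 𝓞 K →+* End (A i))
      (θ : ∀ i : Fin 6, K →+* Module.End ℂ (complexBetti (A i).X 1)),
      Function.Injective e ∧ (∀ t, t ∈ Φ.1 ↔ t ∈ Set.range e) ∧
      (∀ i, IsCMTypeRealisation (hazamaFamily Φ e i) (A i) (ι i) (θ i)) ∧
      ∃ c : complexBetti (⨁ A).X (2 * 3), IsRationalClass c ∧ IsOfHodgeType (⨁ A).dim (⨁ A).X (2 * 3) 3 3 c ∧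
        c ∉ divisorIdealSix (⨁ A).dim (⨁ A).X ∧ c ∉ codimTwoGeneratedSix (⨁ A).dim (⨁ A).X ∧
        c ∉ divisorClassesSpan (⨁ A).X (⨁ A).dim 3 :=
  exists_cmProduct_hodgeRing_not_generated_in_codim_two PicardCM.CMAbelianVarietyRealised_holds K hK Φ

/-- **Closed existence form of the barrier**: there is a complex abelian variety `B` (the product of six CM abelian
fourfolds with `𝓞_K`-multiplication, `K = ℚ(α, i)` Mumford's octic CM field of `Pohlmann1968/MumfordSimpleFourfold`,
of the six types of Hazama's Remark 7.15 for any CM type of `K`) carrying a rational Hodge class of type `(3,3)` in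
`H⁶(B(ℂ); ℂ)` which lies outside `B¹B¹B¹ + B¹B² + B²B¹` (complexified: the degree-`6` part of the subalgebra
generated by the Hodge classes of codimension `≤ 2`), outside the ideal generated by `B¹ ⊗ ℂ`, and outside
`D³ ⊗ ℂ`. [cite: Hazama2003GHCCM, Remark 7.15 p. 650] [cite: Pohlmann1968, Thm. 1 and §3]
[cite: Shimura1998, §6.2 Theorem 3] -/
theorem exists_abelianVariety_hodgeRing_not_generated_in_codim_two :
    ∃ (B : AbelianVariety ℂ) (c : complexBetti B.X (2 * 3)),
      IsRationalClass c ∧ IsOfHodgeType B.dim B.X (2 * 3) 3 3 c ∧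
        c ∉ codimTwoGeneratedSix B.dim B.X ∧ c ∉ divisorIdealSix B.dim B.X ∧ c ∉ divisorClassesSpan B.X B.dim 3 := by
  obtain ⟨Φ⟩ := Literature.AlgebraicGeometry.ComplexMultiplication.nonempty_cmType_of_isCMField
    (K := MumfordFourfold.K)
  obtain ⟨e, A, ι, θ, -, -, -, c, hcQ, hcH, hI, hC, hD⟩ :=
    cmProduct_hodgeRing_not_generated_in_codim_two MumfordFourfold.K MumfordFourfold.finrank_K Φ
  exact ⟨⨁ A, c, hcQ, hcH, hC, hI, hD⟩

end Literature.Barriers.HodgeConjecture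

/-! ### §3 The dimensions of simple CM abelian varieties with exceptional Hodge classes, hypothesis-free -/

namespace Literature.AlgebraicGeometry.Pohlmann1968

open CategoryTheory NumberField
open Literature.NumberTheory.ComplexMultiplication
open Literature.NumberTheory.NumberFields
open Literature.NumberTheory.Automorphic (PicardCM.CMAbelianVarietyRealised_holds)
open Literature.AlgebraicGeometry.Motives (AbelianVariety CMType IsSmoothProjective hodgeTensorFacts_holds)
open Literature.AlgebraicGeometry.Motives.AbelianVariety
open Literature.AlgebraicGeometry.HodgeTheory
open Literature.AlgebraicGeometry.ComplexMultiplication (IsCMTypeRealisation)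
open Literature.AlgebraicGeometry.Milne1999
open Literature.Barriers.HodgeConjecture (divisorClassesSpan)

/-- **A SIMPLE complex abelian FOURFOLD of CM type which is itself not divisor-generated exists** (Mumford's example,
Pohlmann 1968 §3; van Geemen Thm. 4.5; Dodson §3.3.2), hypothesis-free:
`exists_isSimple_isOfCMType_fourfold_not_isDivisorGenerated` at `PicardCM.CMAbelianVarietyRealised_holds`.
[cite: Pohlmann1968, §3] [cite: vanGeemen1994HodgeAV, Thm. 4.5 and 4.7] [cite: Shimura1998, §6.2 Thm. 3 and §8.2 Prop. 26] -/
theorem exists_simple_cmType_fourfold_not_isDivisorGenerated :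
    ∃ X : AbelianVariety ℂ, X.IsSimple ∧ IsOfCMType X ∧ X.dim = 4 ∧ ¬ IsDivisorGenerated X :=
  exists_isSimple_isOfCMType_fourfold_not_isDivisorGenerated PicardCM.CMAbelianVarietyRealised_holds

/-- **Dodson's converse to Ribet's theorem in every composite dimension, hypothesis-free** (Dodson 1984, abstract:
«simple degenerate Abelian varieties of CM-type are constructed in every composite dimension»; `n = 4`:
Mumford–Pohlmann, the variety itself; `n > 4`: §3.2.1): for `n ≥ 4` not a prime there is a SIMPLE complex abelian
variety of CM type and dimension `n` some power of which is NOT divisor-generated (an exceptional Hodge class).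
[cite: Dodson1984, abstract and §3.2.1 Theorem] [cite: Pohlmann1968, §3] [cite: Shimura1998, §6.2 Thm. 3] -/
theorem exists_simple_cmType_not_isDivisorGenerated_powSucc {n : ℕ} (h4 : 4 ≤ n) (hn : ¬ n.Prime) :
    ∃ X : AbelianVariety ℂ, X.IsSimple ∧ IsOfCMType X ∧ X.dim = n ∧ ∃ N : ℕ, ¬ IsDivisorGenerated (X.powSucc N) :=
  exists_isSimple_isOfCMType_not_isDivisorGenerated_powSucc_of_not_prime PicardCM.CMAbelianVarietyRealised_holds h4 hn

/-- **THE DIMENSIONS OF SIMPLE CM ABELIAN VARIETIES WITH EXCEPTIONAL HODGE CLASSES ARE EXACTLY THE COMPOSITE NUMBERS,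
hypothesis-free** (Ribet 1983 + Ribet 1980 (3.7) ⟹; Mumford–Pohlmann 1968 + Dodson 1984 §3.2.1 ⟸, the latter
through Shimura's existence theorem `PicardCM.CMAbelianVarietyRealised_holds`): for `n ≥ 1` there is a SIMPLE complex
abelian variety `X` of CM type with `dim X = n` and a power `X^{N+1}` which is NOT divisor-generated
(`B•(X^{N+1}) ≠ D•(X^{N+1})`) if and only if `n` is not a prime and `n ≥ 4`.
[cite: Dodson1984, abstract and p. 2] [cite: Ribet1983, Thms. 0–3] [cite: Pohlmann1968, §3]
[cite: Gordon1999HodgeAVSurvey, Thm. 6.3, Thm. 6.4 and 8.2] [cite: Shimura1998, §6.2 Thm. 3] -/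
theorem exists_simple_cmType_not_isDivisorGenerated_powSucc_iff {n : ℕ} (hn : 0 < n) :
    (∃ X : AbelianVariety ℂ, X.IsSimple ∧ IsOfCMType X ∧ X.dim = n ∧
        ∃ N : ℕ, ¬ IsDivisorGenerated (X.powSucc N)) ↔ ¬ n.Prime ∧ 4 ≤ n :=
  exists_isSimple_isOfCMType_not_isDivisorGenerated_powSucc_iff PicardCM.CMAbelianVarietyRealised_holds hn

/-- **The same dichotomy with «degenerate» in Dodson's sense, hypothesis-free**: for `n ≥ 1` there is a SIMPLE
complex abelian variety `X` of CM type, `dim X = n`, whose Mumford–Tate group has `dim MT(H¹(X)) < n + 1` iff `n`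
is not a prime and `n ≥ 4` (Hazama's criterion, Gordon Thm. 6.4, and Kubota's bound).
[cite: Dodson1984, abstract and p. 2] [cite: Gordon1999HodgeAVSurvey, Thm. 6.4 and 9.1] [cite: Ribet1983, Thms. 0–3]
[cite: Shimura1998, §6.2 Thm. 3] -/
theorem exists_simple_cmType_mtRank_lt_iff {n : ℕ} (hn : 0 < n) :
    (∃ (X : AbelianVariety ℂ) (hX : IsSmoothProjective n X.X), X.IsSimple ∧ IsOfCMType X ∧ X.dim = n ∧
        (haveI := BettiUniverse.finite hX 1
         @Motives.HodgeStructure.mtRank _ _ _ hodgeTensorFacts_holds.{0, 0} _ _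
            (BettiUniverse.hodge exists_isReal_hodgeModel_holds hX 1) < n + 1)) ↔ ¬ n.Prime ∧ 4 ≤ n :=
  exists_isSimple_isOfCMType_mtRank_lt_iff PicardCM.CMAbelianVarietyRealised_holds hn

/-- **Dodson 1984 §3.2.1 (A Converse of Ribet's Theorem), rank form, hypothesis-free**: for `n = kl` with `k ≥ 3`,
`l ≥ 2` there is a SIMPLE abelian variety `A` of CM type `(K; Φ)` (`[K : ℚ] = 2n`), `dim A = n`, DEGENERATE of rank
`dim MT(H¹(A)) = n − l + 2`, some power of which carries an exceptional Hodge class.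
[cite: Dodson1984, §3.2.1 Theorem] [cite: Shimura1998, §6.2 Thm. 3] -/
theorem exists_simple_degenerate_cmType_of_eq_mul {n k l : ℕ} (hk : 3 ≤ k) (hl : 2 ≤ l) (hn : n = k * l) :
    ∃ (K : Type) (_ : Field K) (_ : NumberField K) (_ : IsCMField K) (Φ : CMType K) (A : AbelianVariety ℂ)
      (ι : 𝓞 K →+* End A) (θ : K →+* Module.End ℂ (complexBetti A.X 1)) (hA : IsCMTypeRealisation Φ A ι θ),
      Module.finrank ℚ K = 2 * n ∧ A.IsSimple ∧ A.dim = n ∧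
        (haveI := BettiUniverse.finite hA.1 1
         @Motives.HodgeStructure.mtRank _ _ _ Motives.hodgeTensorFacts_holds.{0, 0} _ _
           (BettiUniverse.hodge exists_isReal_hodgeModel_holds hA.1 1) = n - l + 2) ∧
        ∃ N m : ℕ, ∃ c : complexBetti (⨁ fun _ : Fin N => A).X (2 * m), IsRationalClass c ∧
          IsOfHodgeType (⨁ fun _ : Fin N => A).dim (⨁ fun _ : Fin N => A).X (2 * m) m m c ∧
          c ∉ divisorClassesSpan (⨁ fun _ : Fin N => A).X (⨁ fun _ : Fin N => A).dim m :=
  exists_simple_degenerate_of_eq_mul PicardCM.CMAbelianVarietyRealised_holds hk hl hn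

/-- **Dodson 1984 §3.2.1 as printed, hypothesis-free: «Let `n > 4` be composite […] Then there exist simple
degenerate Abelian varieties of dimension `n`»** — a simple abelian `n`-fold of CM type with `dim MT(H¹(A)) < n + 1`
and an exceptional Hodge class on some power. [cite: Dodson1984, §3.2.1 Theorem] [cite: Shimura1998, §6.2 Thm. 3] -/
theorem exists_simple_degenerate_cmType_of_not_prime {n : ℕ} (h4 : 4 < n) (hn : ¬ n.Prime) :
    ∃ (K : Type) (_ : Field K) (_ : NumberField K) (_ : IsCMField K) (Φ : CMType K) (A : AbelianVariety ℂ)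
      (ι : 𝓞 K →+* End A) (θ : K →+* Module.End ℂ (complexBetti A.X 1)) (hA : IsCMTypeRealisation Φ A ι θ),
      A.IsSimple ∧ A.dim = n ∧
        (haveI := BettiUniverse.finite hA.1 1
         @Motives.HodgeStructure.mtRank _ _ _ Motives.hodgeTensorFacts_holds.{0, 0} _ _
           (BettiUniverse.hodge exists_isReal_hodgeModel_holds hA.1 1) < n + 1) ∧
        ∃ N m : ℕ, ∃ c : complexBetti (⨁ fun _ : Fin N => A).X (2 * m), IsRationalClass c ∧
          IsOfHodgeType (⨁ fun _ : Fin N => A).dim (⨁ fun _ : Fin N => A).X (2 * m) m m c ∧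
          c ∉ divisorClassesSpan (⨁ fun _ : Fin N => A).X (⨁ fun _ : Fin N => A).dim m :=
  exists_simple_degenerate_of_not_prime PicardCM.CMAbelianVarietyRealised_holds h4 hn

end Literature.AlgebraicGeometry.Pohlmann1968

end
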